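import Summits.BirchSwinnertonDyer.BirchSwinnertonDyer.Theorems.ByReductionTypeAtTwoAdditivePotMultConjATwoNarrowTwo6728Dyadic
import Summits.BirchSwinnertonDyer.BirchSwinnertonDyer.Theorems.ByReductionTypeAtTwoFineSelmerConjAAtTwoAdditivePotGoodNarrowRankCertificate316LayerOneTotPos
import Summits.BirchSwinnertonDyer.BirchSwinnertonDyer.Theorems.ByReductionTypeAtTwoFineSelmerConjAAtTwoAdditivePotGoodNarrowRankCertificate316LayerTwoParity
import Summits.BirchSwinnertonDyer.BirchSwinnertonDyer.Theorems.ByReductionTypeAtTwoAdditivePotGoodLowerHalfT0NarrowRankLayerTwoResidueMap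
import Summits.BirchSwinnertonDyer.BirchSwinnertonDyer.Theorems.ByReductionTypeAtTwoAdditivePotGoodLowerHalfT0NarrowRankTotPosUnitsCounting
import HarnessLib

/-!
# C4″ `AdditivePotMultOverKAtTwo` (item stmt-BirchSwinnertonDyer-22618), the (I1M′) input of the upper half on the `0 < Δ` rows:
# LAYER-TWO NARROW CERTIFICATE `d = 6728` (S₃-CLOSURE ROAD), part TOTPOS — two totally positive units `u ∈ E`, `v ∈ A₁ = ℚ(θ) ⊔ ℚ_1` with `u, v, uv` non-squares
# (residue maps through `A₂`), so `#(U⁺/U²)(A₁) ≥ 4` — the downstairs input `a = 2` of the Edgar–Mollin–Peterson door (KERNEL; rows 121104ct1, 336400cb1)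

Cell `bsd-2adic`, rung K4, seat `bsd-2adic-k4-w3` GEN 15 (explicit unit of director-bsd g16 (309)(7); `--supports stmt-BirchSwinnertonDyer-22618`).
HONEST FRAMING (D-0036/D-0054/D-0152): THEOREMS ONLY (no definition, no named fact, no `sorry`, no instance). The series `…NarrowTwo6728{Class, Field,
Dyadic, ParityOne, TotPos, Integers, Parity, SignsW…, Units, Row…}` is the S₃-CLOSURE ROAD of the layer-two narrow certificate: the totally real cubic
`2`-torsion field `E` of discriminant `6728 = 8·m²` (`X³ + (0)X² + (-29)X + (58)`) has Galois closure `A₁ = E(√2) = ℚ(θ) ⊔ ℚ_1` (group `S₃`), so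
`2 = (π₁π₂π₃)²` in `A₁` (three dyadic primes, `e = 2`, `f = 1`), `A₁/E` is ramified at ONE prime (⇒ `h(A₁)` odd with no unit condition) and
`A₂/A₁` (`A₂ = ℚ(θ) ⊔ ℚ_2 = E(√(2+√2))`) at THREE (⇒ `h(A₂)` odd from TWO independent dyadic non-norm units); `#(U⁺/U²)(A₁) ≥ 4` from two
totally positive units with three residue witnesses (ring maps `𝓞 A₁ → 𝓞 A₂ → 𝔽_ℓ`, k4-w2's `exists_ringHom_ringOfIntegers_sup_layer_two_zmod`),
TEN sign-independent units of `A₂` (with `−1`), k4-w2's Edgar–Mollin–Peterson door with `a = 2`, `b = 10`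
(`[Cl⁺(A₂):Cl⁺(A₂)²] = [Cl⁺(A₁):Cl⁺(A₁)²] = 4`), and cruxlead-19573-w2's rung `m = 1`; C4″ census rows 121104ct1, 336400cb1 (eng-2 CERT-ADD-POTMULT-POS81-AB-E2:
`rank₂ Cl⁺ = [1,2,2]`, `h = 1` at layers `0,1,2`, `n₀ = 1` — letter NARROW-EQUAL12, instrument grade `grh`; here KERNEL).
All certificates were found by the seat's exact-arithmetic tools (`k4w3/gen15/tools`: `s3explore`, `certs3`, GEN 13/14 `nf12/unitlib`) and are CHECKED HERE by the
kernel. Statement (A) is NOT BSD: BSD₂ for these curves is not proved; C4″ / (I1M′) stay research-open; nothing booked; no row of 22618 changes tier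
(pen RC-490 (4)); BSD is not proved by any of this.

References: [CoatesSujatha2005] Conj. A, Thm. 3.4; [Fukuda1994] Thm. 1 (2); [EdgarMollinPeterson1986] Thm. 2.1; [FrohlichTaylor1990] Ch. V §1 (1.8)–(1.13);
[Lang1990] Ch. 13 §4 Lemma 4.1; [Washington1997] §13.1, Prop. 13.2; [Cohen1993] §4.1.3, §6.3; [Marcus1977] Ch. 3 Thm. 27, Ch. 5 Thm. 22; [Omeara1963] §63.
-/

set_option autoImplicit false
-- sibling precedent: the directory name repeats the summit name
set_option linter.dupNamespace false

noncomputable section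

open scoped Classical IntermediateField NumberField nonZeroDivisors Polynomial

namespace Summit.BirchSwinnertonDyer.BirchSwinnertonDyer.Theorems.AddKatoTwo

open Polynomial IsDedekindDomain NumberField Field IntermediateField
  Literature.NumberTheory.EllipticCurves Literature.NumberTheory.EllipticCurves.ZpExtension
  Literature.NumberTheory.IwasawaTheory Literature.NumberTheory.NumberFields
  Literature.NumberTheory.GaloisRepresentations Literature.Geometry.Kaehler.ComplexTorus

variable {θ : AlgebraicClosure ℚ}

set_option linter.unusedSimpArgs false in
set_option maxHeartbeats 3200000 in
set_option maxRecDepth 20000 in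
/-- **`#(U⁺/U²)(ℚ(θ) ⊔ ℚ_1) ≥ 4` for `θ³ + (0)θ² + (-29)θ + (58) = 0`** (`d = 6728`, `A₁ = E(√2)` the `S₃` closure): the units `u = 1 - 3 * θ + θ ^ 2` (of `E`) and
`v = -36 - 195 * ω + 6 * θ + 43 * θ * ω + 3 * θ ^ 2 + 12 * θ ^ 2 * ω` of `ℤ[θ, ω]` are TOTALLY POSITIVE (six located real embeddings, linear interval arithmetic) and `u`, `v`, `uv` are NOT unit squares:
each maps under a ring map `𝓞 A₁ → 𝓞 A₂ → 𝔽_{193}` (k4-w2's `exists_ringHom_ringOfIntegers_sup_layer_two_zmod'` through the order `ℤ[θ, e]`, composed with `𝓞 A₁ → 𝓞 A₂`)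
to a quadratic non-residue (`decide`); k4-w2's counting door `four_le_card_totPosUnitsModSq_of_ne_sq`. The downstairs input `a = 2` of the Edgar–Mollin–Peterson door. KERNEL.
[cite: FrohlichTaylor1990, Ch. V §1 (1.10)–(1.12), pp. 163–164] [cite: Cohen1993, §4.1.3] [cite: Marcus1977, Ch. 3 Thm. 27] [cite: Washington1997, §13.1] -/
theorem four_le_card_totPosUnitsModSq_adjoin_sup_layer_one_d6728 (hθ : aeval θ (Cubic.toPoly ⟨1, ((0 : ℤ) : ℚ), ((-29 : ℤ) : ℚ), ((58 : ℤ) : ℚ)⟩) = 0) :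
    haveI : FiniteDimensional ℚ ↥ℚ⟮θ⟯ :=
      IntermediateField.adjoin.finiteDimensional ⟨_, Cubic.monic_of_a_eq_one', by rwa [← aeval_def]⟩
    haveI : FiniteDimensional ℚ ↥((CyclotomicZp.zpExtension 2).layer 1) := (CyclotomicZp.zpExtension 2).finiteDimensional_layer_holds 1
    haveI : NumberField ↥(ℚ⟮θ⟯ ⊔ (CyclotomicZp.zpExtension 2).layer 1) := NumberField.mk
    4 ≤ Nat.card (TotPosUnitsModSq ↥(ℚ⟮θ⟯ ⊔ (CyclotomicZp.zpExtension 2).layer 1)) := by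
  haveI : FiniteDimensional ℚ ↥ℚ⟮θ⟯ :=
    IntermediateField.adjoin.finiteDimensional ⟨_, Cubic.monic_of_a_eq_one', by rwa [← aeval_def]⟩
  haveI : FiniteDimensional ℚ ↥((CyclotomicZp.zpExtension 2).layer 1) := (CyclotomicZp.zpExtension 2).finiteDimensional_layer_holds 1
  haveI : NumberField ↥ℚ⟮θ⟯ := NumberField.mk
  haveI : NumberField ↥(ℚ⟮θ⟯ ⊔ (CyclotomicZp.zpExtension 2).layer 1) := NumberField.mk
  haveI : FiniteDimensional ℚ ↥((CyclotomicZp.zpExtension 2).layer 2) := (CyclotomicZp.zpExtension 2).finiteDimensional_layer_holds 2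
  haveI : NumberField ↥(ℚ⟮θ⟯ ⊔ (CyclotomicZp.zpExtension 2).layer 2) := NumberField.mk
  obtain ⟨hreal, hfinA, h3⟩ := layer_one_basics irreducible_cubic_d6728p hθ (isTotallyReal_adjoin_d6728p hθ)
  haveI := hreal
  obtain ⟨e, he, -, he4⟩ := CyclotomicZp.exists_mem_layer_two_quartic_zpExtension
  have he0 : (fun x : AlgebraicClosure ℚ => x ^ 2 - 2)^[2] e = 0 := by
    simp only [Function.iterate_succ, Function.iterate_zero, Function.comp_apply, id_eq]
    linear_combination he4
  obtain ⟨ht, ht2⟩ := sq_sub_two_mem_layer_one_d316 he0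
  have hKA : ℚ⟮θ⟯ ≤ ℚ⟮θ⟯ ⊔ (CyclotomicZp.zpExtension 2).layer 1 := le_sup_left
  have hK2 : ℚ⟮θ⟯ ≤ ℚ⟮θ⟯ ⊔ (CyclotomicZp.zpExtension 2).layer 2 := le_sup_left
  have h12 : ℚ⟮θ⟯ ⊔ (CyclotomicZp.zpExtension 2).layer 1 ≤ ℚ⟮θ⟯ ⊔ (CyclotomicZp.zpExtension 2).layer 2 :=
    sup_le_sup_left ((CyclotomicZp.zpExtension 2).layer_mono (by norm_num : 1 ≤ 2)) _
  have htA : e ^ 2 - 2 ∈ ℚ⟮θ⟯ ⊔ (CyclotomicZp.zpExtension 2).layer 1 := (le_sup_right : (CyclotomicZp.zpExtension 2).layer 1 ≤ _) ht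
  have heA : e ∈ ℚ⟮θ⟯ ⊔ (CyclotomicZp.zpExtension 2).layer 2 := (le_sup_right : (CyclotomicZp.zpExtension 2).layer 2 ≤ _) he
  set t' : ↥(ℚ⟮θ⟯ ⊔ (CyclotomicZp.zpExtension 2).layer 1) := ⟨e ^ 2 - 2, htA⟩ with ht'def
  set e'' : ↥(ℚ⟮θ⟯ ⊔ (CyclotomicZp.zpExtension 2).layer 2) := ⟨e, heA⟩ with he''def
  set θ' : ↥(ℚ⟮θ⟯ ⊔ (CyclotomicZp.zpExtension 2).layer 1) := inclusion hKA (AdjoinSimple.gen ℚ θ) with hθ'def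
  obtain ⟨ρ₀, ρ₁, ρ₂, x₀, x₁, x₂, hρ₀, hρ₁, hρ₂, hl₀, hu₀, hl₁, hu₁, hl₂, hu₂⟩ := exists_three_ringHom_adjoin_d6728p hθ
  have hs2l : ((1767766952966368811 : ℝ) / 1250000000000000000) < Real.sqrt 2 :=
    (Real.lt_sqrt (by norm_num)).mpr (by norm_num)
  have hs2u : Real.sqrt 2 < ((141421356237309504881 : ℝ) / 100000000000000000000) :=
    (Real.sqrt_lt' (by norm_num)).mpr (by norm_num)
  have hysq : (Real.sqrt 2) ^ 2 = 2 := Real.sq_sqrt (by norm_num)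
  obtain ⟨bA, xA, sA, hbAval, hsAval, hxval, RbA, RxA, hs, hsA2, -, -, -⟩ := layer_one_dyadic_d6728 hθ ht ht2
  have hθ'rel : 58 - 29 * θ' + θ' ^ 3 = 0 := by
    have h := congrArg (algebraMap (𝓞 ↥(ℚ⟮θ⟯ ⊔ (CyclotomicZp.zpExtension 2).layer 1)) ↥(ℚ⟮θ⟯ ⊔ (CyclotomicZp.zpExtension 2).layer 1)) RbA
    simp only [map_add, map_sub, map_mul, map_pow, map_zero, map_ofNat, map_zero, map_neg, map_one] at h
    rw [← NumberField.RingOfIntegers.coe_eq_algebraMap, hbAval] at h; exact h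
  have hxval' : (xA : ↥(ℚ⟮θ⟯ ⊔ (CyclotomicZp.zpExtension 2).layer 1)) = ((-12 - 4 * θ' + 2 * θ' ^ 2) + t' * (-2 - 3 * θ' + θ' ^ 2)) / 4 := hxval
  have hval : ∀ (σ : ↥(ℚ⟮θ⟯ ⊔ (CyclotomicZp.zpExtension 2).layer 1) →+* ℝ) (x y : ℝ), σ θ' = x → σ t' = y →
      σ (algebraMap (𝓞 ↥(ℚ⟮θ⟯ ⊔ (CyclotomicZp.zpExtension 2).layer 1)) ↥(ℚ⟮θ⟯ ⊔ (CyclotomicZp.zpExtension 2).layer 1) bA) = x ∧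
      σ (algebraMap (𝓞 ↥(ℚ⟮θ⟯ ⊔ (CyclotomicZp.zpExtension 2).layer 1)) ↥(ℚ⟮θ⟯ ⊔ (CyclotomicZp.zpExtension 2).layer 1) xA) = ((-12 - 4 * x + 2 * x ^ 2) + y * (-2 - 3 * x + x ^ 2)) / 4 ∧ 58 - 29 * x + x ^ 3 = 0 := by
    intro σ x y hx hy
    have hb : σ (algebraMap _ _ bA) = x := by rw [← NumberField.RingOfIntegers.coe_eq_algebraMap, hbAval, hx]
    have hxrel : 58 - 29 * x + x ^ 3 = 0 := by
      have h := congrArg σ hθ'rel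
      simp only [map_add, map_sub, map_mul, map_pow, map_zero, map_ofNat, map_zero, map_neg, map_one, hx] at h; exact h
    refine ⟨hb, ?_, hxrel⟩
    rw [← NumberField.RingOfIntegers.coe_eq_algebraMap, hxval']
    simp only [map_add, map_sub, map_mul, map_pow, map_zero, map_ofNat, map_neg, map_one, map_div₀, hy, hx]
  obtain ⟨-, -, -, -, -, -, -, -, huinv, hvinv⟩ := layer_one_unit_ids_d6728 bA xA RbA RxA
  set eU : (𝓞 ↥(ℚ⟮θ⟯ ⊔ (CyclotomicZp.zpExtension 2).layer 1))ˣ := Units.mkOfMulEqOne _ _ huinv with heUdef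
  set eV : (𝓞 ↥(ℚ⟮θ⟯ ⊔ (CyclotomicZp.zpExtension 2).layer 1))ˣ := Units.mkOfMulEqOne _ _ hvinv with heVdef
  obtain ⟨σ₁, hσ₁K, hσ₁t⟩ := exists_ringHom_sup_layer_one irreducible_cubic_d6728p hθ (isTotallyReal_adjoin_d6728p hθ) ht ht2 ρ₀ (Real.sqrt 2) (Or.inl rfl)
  have hσ₁θ : σ₁ θ' = x₀ := by rw [hθ'def, hσ₁K, hρ₀]
  obtain ⟨hσ₁b, hσ₁x, hσ₁r⟩ := hval σ₁ x₀ (Real.sqrt 2) hσ₁θ hσ₁t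
  obtain ⟨σ₂, hσ₂K, hσ₂t⟩ := exists_ringHom_sup_layer_one irreducible_cubic_d6728p hθ (isTotallyReal_adjoin_d6728p hθ) ht ht2 ρ₀ (-Real.sqrt 2) (Or.inr rfl)
  have hσ₂θ : σ₂ θ' = x₀ := by rw [hθ'def, hσ₂K, hρ₀]
  obtain ⟨hσ₂b, hσ₂x, hσ₂r⟩ := hval σ₂ x₀ (-Real.sqrt 2) hσ₂θ hσ₂t
  obtain ⟨σ₃, hσ₃K, hσ₃t⟩ := exists_ringHom_sup_layer_one irreducible_cubic_d6728p hθ (isTotallyReal_adjoin_d6728p hθ) ht ht2 ρ₁ (Real.sqrt 2) (Or.inl rfl)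
  have hσ₃θ : σ₃ θ' = x₁ := by rw [hθ'def, hσ₃K, hρ₁]
  obtain ⟨hσ₃b, hσ₃x, hσ₃r⟩ := hval σ₃ x₁ (Real.sqrt 2) hσ₃θ hσ₃t
  obtain ⟨σ₄, hσ₄K, hσ₄t⟩ := exists_ringHom_sup_layer_one irreducible_cubic_d6728p hθ (isTotallyReal_adjoin_d6728p hθ) ht ht2 ρ₁ (-Real.sqrt 2) (Or.inr rfl)
  have hσ₄θ : σ₄ θ' = x₁ := by rw [hθ'def, hσ₄K, hρ₁]
  obtain ⟨hσ₄b, hσ₄x, hσ₄r⟩ := hval σ₄ x₁ (-Real.sqrt 2) hσ₄θ hσ₄t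
  obtain ⟨σ₅, hσ₅K, hσ₅t⟩ := exists_ringHom_sup_layer_one irreducible_cubic_d6728p hθ (isTotallyReal_adjoin_d6728p hθ) ht ht2 ρ₂ (Real.sqrt 2) (Or.inl rfl)
  have hσ₅θ : σ₅ θ' = x₂ := by rw [hθ'def, hσ₅K, hρ₂]
  obtain ⟨hσ₅b, hσ₅x, hσ₅r⟩ := hval σ₅ x₂ (Real.sqrt 2) hσ₅θ hσ₅t
  obtain ⟨σ₆, hσ₆K, hσ₆t⟩ := exists_ringHom_sup_layer_one irreducible_cubic_d6728p hθ (isTotallyReal_adjoin_d6728p hθ) ht ht2 ρ₂ (-Real.sqrt 2) (Or.inr rfl)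
  have hσ₆θ : σ₆ θ' = x₂ := by rw [hθ'def, hσ₆K, hρ₂]
  obtain ⟨hσ₆b, hσ₆x, hσ₆r⟩ := hval σ₆ x₂ (-Real.sqrt 2) hσ₆θ hσ₆t
  have hXl₀ : ((619387514448636204021 : ℝ) / 100000000000000000000) < -x₀ := by linarith [hu₀]
  have hXu₀ : -x₀ < ((309693757224318102011 : ℝ) / 50000000000000000000) := by linarith [hl₀]
  obtain ⟨hXXl₀, hXXu₀⟩ := Ioo_mul_bounds (by norm_num) (by norm_num) hXl₀ hXu₀ hXl₀ hXu₀
  obtain ⟨hYXl₀, hYXu₀⟩ := Ioo_mul_bounds (by norm_num) (by norm_num) hs2l hs2u hXl₀ hXu₀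
  obtain ⟨hYXXl₀, hYXXu₀⟩ := Ioo_mul_bounds (by norm_num) (by norm_num) hs2l hs2u hXXl₀ hXXu₀
  obtain ⟨hXXl₁, hXXu₁⟩ := Ioo_mul_bounds (by norm_num) (by norm_num) hl₁ hu₁ hl₁ hu₁
  obtain ⟨hYXl₁, hYXu₁⟩ := Ioo_mul_bounds (by norm_num) (by norm_num) hs2l hs2u hl₁ hu₁
  obtain ⟨hYXXl₁, hYXXu₁⟩ := Ioo_mul_bounds (by norm_num) (by norm_num) hs2l hs2u hXXl₁ hXXu₁
  obtain ⟨hXXl₂, hXXu₂⟩ := Ioo_mul_bounds (by norm_num) (by norm_num) hl₂ hu₂ hl₂ hu₂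
  obtain ⟨hYXl₂, hYXu₂⟩ := Ioo_mul_bounds (by norm_num) (by norm_num) hs2l hs2u hl₂ hu₂
  obtain ⟨hYXXl₂, hYXXu₂⟩ := Ioo_mul_bounds (by norm_num) (by norm_num) hs2l hs2u hXXl₂ hXXu₂
  have suσ₁ : 0 < σ₁ ((eU : 𝓞 ↥(ℚ⟮θ⟯ ⊔ (CyclotomicZp.zpExtension 2).layer 1)) : ↥(ℚ⟮θ⟯ ⊔ (CyclotomicZp.zpExtension 2).layer 1)) := by
    have hv : σ₁ ((eU : 𝓞 ↥(ℚ⟮θ⟯ ⊔ (CyclotomicZp.zpExtension 2).layer 1)) : ↥(ℚ⟮θ⟯ ⊔ (CyclotomicZp.zpExtension 2).layer 1)) = (1 : ℝ) + (3 : ℝ) * (-x₀) + (1 : ℝ) * ((-x₀) * (-x₀)) := by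
      rw [heUdef, Units.val_mkOfMulEqOne, NumberField.RingOfIntegers.coe_eq_algebraMap]
      simp only [map_add, map_sub, map_mul, map_pow, map_zero, map_neg, map_one, map_ofNat, hσ₁b, hσ₁x]
      ring
    rw [hv]; linarith [hXXl₀, hXXu₀, hYXl₀, hYXu₀, hYXXl₀, hYXXu₀, hs2l, hs2u, hXl₀, hXu₀]
  have suσ₂ : 0 < σ₂ ((eU : 𝓞 ↥(ℚ⟮θ⟯ ⊔ (CyclotomicZp.zpExtension 2).layer 1)) : ↥(ℚ⟮θ⟯ ⊔ (CyclotomicZp.zpExtension 2).layer 1)) := by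
    have hv : σ₂ ((eU : 𝓞 ↥(ℚ⟮θ⟯ ⊔ (CyclotomicZp.zpExtension 2).layer 1)) : ↥(ℚ⟮θ⟯ ⊔ (CyclotomicZp.zpExtension 2).layer 1)) = (1 : ℝ) + (3 : ℝ) * (-x₀) + (1 : ℝ) * ((-x₀) * (-x₀)) := by
      rw [heUdef, Units.val_mkOfMulEqOne, NumberField.RingOfIntegers.coe_eq_algebraMap]
      simp only [map_add, map_sub, map_mul, map_pow, map_zero, map_neg, map_one, map_ofNat, hσ₂b, hσ₂x]
      ring
    rw [hv]; linarith [hXXl₀, hXXu₀, hYXl₀, hYXu₀, hYXXl₀, hYXXu₀, hs2l, hs2u, hXl₀, hXu₀]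
  have suσ₃ : 0 < σ₃ ((eU : 𝓞 ↥(ℚ⟮θ⟯ ⊔ (CyclotomicZp.zpExtension 2).layer 1)) : ↥(ℚ⟮θ⟯ ⊔ (CyclotomicZp.zpExtension 2).layer 1)) := by
    have hv : σ₃ ((eU : 𝓞 ↥(ℚ⟮θ⟯ ⊔ (CyclotomicZp.zpExtension 2).layer 1)) : ↥(ℚ⟮θ⟯ ⊔ (CyclotomicZp.zpExtension 2).layer 1)) = (1 : ℝ) + (-3 : ℝ) * x₁ + (1 : ℝ) * (x₁ * x₁) := by
      rw [heUdef, Units.val_mkOfMulEqOne, NumberField.RingOfIntegers.coe_eq_algebraMap]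
      simp only [map_add, map_sub, map_mul, map_pow, map_zero, map_neg, map_one, map_ofNat, hσ₃b, hσ₃x]
      ring
    rw [hv]; linarith [hXXl₁, hXXu₁, hYXl₁, hYXu₁, hYXXl₁, hYXXu₁, hs2l, hs2u, hl₁, hu₁]
  have suσ₄ : 0 < σ₄ ((eU : 𝓞 ↥(ℚ⟮θ⟯ ⊔ (CyclotomicZp.zpExtension 2).layer 1)) : ↥(ℚ⟮θ⟯ ⊔ (CyclotomicZp.zpExtension 2).layer 1)) := by
    have hv : σ₄ ((eU : 𝓞 ↥(ℚ⟮θ⟯ ⊔ (CyclotomicZp.zpExtension 2).layer 1)) : ↥(ℚ⟮θ⟯ ⊔ (CyclotomicZp.zpExtension 2).layer 1)) = (1 : ℝ) + (-3 : ℝ) * x₁ + (1 : ℝ) * (x₁ * x₁) := by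
      rw [heUdef, Units.val_mkOfMulEqOne, NumberField.RingOfIntegers.coe_eq_algebraMap]
      simp only [map_add, map_sub, map_mul, map_pow, map_zero, map_neg, map_one, map_ofNat, hσ₄b, hσ₄x]
      ring
    rw [hv]; linarith [hXXl₁, hXXu₁, hYXl₁, hYXu₁, hYXXl₁, hYXXu₁, hs2l, hs2u, hl₁, hu₁]
  have suσ₅ : 0 < σ₅ ((eU : 𝓞 ↥(ℚ⟮θ⟯ ⊔ (CyclotomicZp.zpExtension 2).layer 1)) : ↥(ℚ⟮θ⟯ ⊔ (CyclotomicZp.zpExtension 2).layer 1)) := by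
    have hv : σ₅ ((eU : 𝓞 ↥(ℚ⟮θ⟯ ⊔ (CyclotomicZp.zpExtension 2).layer 1)) : ↥(ℚ⟮θ⟯ ⊔ (CyclotomicZp.zpExtension 2).layer 1)) = (1 : ℝ) + (-3 : ℝ) * x₂ + (1 : ℝ) * (x₂ * x₂) := by
      rw [heUdef, Units.val_mkOfMulEqOne, NumberField.RingOfIntegers.coe_eq_algebraMap]
      simp only [map_add, map_sub, map_mul, map_pow, map_zero, map_neg, map_one, map_ofNat, hσ₅b, hσ₅x]
      ring
    rw [hv]; linarith [hXXl₂, hXXu₂, hYXl₂, hYXu₂, hYXXl₂, hYXXu₂, hs2l, hs2u, hl₂, hu₂]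
  have suσ₆ : 0 < σ₆ ((eU : 𝓞 ↥(ℚ⟮θ⟯ ⊔ (CyclotomicZp.zpExtension 2).layer 1)) : ↥(ℚ⟮θ⟯ ⊔ (CyclotomicZp.zpExtension 2).layer 1)) := by
    have hv : σ₆ ((eU : 𝓞 ↥(ℚ⟮θ⟯ ⊔ (CyclotomicZp.zpExtension 2).layer 1)) : ↥(ℚ⟮θ⟯ ⊔ (CyclotomicZp.zpExtension 2).layer 1)) = (1 : ℝ) + (-3 : ℝ) * x₂ + (1 : ℝ) * (x₂ * x₂) := by
      rw [heUdef, Units.val_mkOfMulEqOne, NumberField.RingOfIntegers.coe_eq_algebraMap]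
      simp only [map_add, map_sub, map_mul, map_pow, map_zero, map_neg, map_one, map_ofNat, hσ₆b, hσ₆x]
      ring
    rw [hv]; linarith [hXXl₂, hXXu₂, hYXl₂, hYXu₂, hYXXl₂, hYXXu₂, hs2l, hs2u, hl₂, hu₂]
  have svσ₁ : 0 < σ₁ ((eV : 𝓞 ↥(ℚ⟮θ⟯ ⊔ (CyclotomicZp.zpExtension 2).layer 1)) : ↥(ℚ⟮θ⟯ ⊔ (CyclotomicZp.zpExtension 2).layer 1)) := by
    have hv : σ₁ ((eV : 𝓞 ↥(ℚ⟮θ⟯ ⊔ (CyclotomicZp.zpExtension 2).layer 1)) : ↥(ℚ⟮θ⟯ ⊔ (CyclotomicZp.zpExtension 2).layer 1)) = (-2 : ℝ) + (-4 : ℝ) * Real.sqrt 2 + ((1 : ℝ) / 2) * (-x₀) + ((-3 : ℝ) / 2) * (Real.sqrt 2 * (-x₀)) + ((1 : ℝ) / 2) * ((-x₀) * (-x₀)) := by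
      rw [heVdef, Units.val_mkOfMulEqOne, NumberField.RingOfIntegers.coe_eq_algebraMap]
      simp only [map_add, map_sub, map_mul, map_pow, map_zero, map_neg, map_one, map_ofNat, hσ₁b, hσ₁x]
      linear_combination (((19 : ℝ) / 2) + ((7 : ℝ) / 4) * (Real.sqrt 2) + (6 : ℝ) * x₀ + (3 : ℝ) * x₀ * (Real.sqrt 2)) * hσ₁r
    rw [hv]; linarith [hXXl₀, hXXu₀, hYXl₀, hYXu₀, hYXXl₀, hYXXu₀, hs2l, hs2u, hXl₀, hXu₀]
  have svσ₂ : 0 < σ₂ ((eV : 𝓞 ↥(ℚ⟮θ⟯ ⊔ (CyclotomicZp.zpExtension 2).layer 1)) : ↥(ℚ⟮θ⟯ ⊔ (CyclotomicZp.zpExtension 2).layer 1)) := by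
    have hv : σ₂ ((eV : 𝓞 ↥(ℚ⟮θ⟯ ⊔ (CyclotomicZp.zpExtension 2).layer 1)) : ↥(ℚ⟮θ⟯ ⊔ (CyclotomicZp.zpExtension 2).layer 1)) = (-2 : ℝ) + (4 : ℝ) * Real.sqrt 2 + ((1 : ℝ) / 2) * (-x₀) + ((3 : ℝ) / 2) * (Real.sqrt 2 * (-x₀)) + ((1 : ℝ) / 2) * ((-x₀) * (-x₀)) := by
      rw [heVdef, Units.val_mkOfMulEqOne, NumberField.RingOfIntegers.coe_eq_algebraMap]
      simp only [map_add, map_sub, map_mul, map_pow, map_zero, map_neg, map_one, map_ofNat, hσ₂b, hσ₂x]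
      linear_combination (((19 : ℝ) / 2) + ((-7 : ℝ) / 4) * (Real.sqrt 2) + (6 : ℝ) * x₀ + (-3 : ℝ) * x₀ * (Real.sqrt 2)) * hσ₂r
    rw [hv]; linarith [hXXl₀, hXXu₀, hYXl₀, hYXu₀, hYXXl₀, hYXXu₀, hs2l, hs2u, hXl₀, hXu₀]
  have svσ₃ : 0 < σ₃ ((eV : 𝓞 ↥(ℚ⟮θ⟯ ⊔ (CyclotomicZp.zpExtension 2).layer 1)) : ↥(ℚ⟮θ⟯ ⊔ (CyclotomicZp.zpExtension 2).layer 1)) := by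
    have hv : σ₃ ((eV : 𝓞 ↥(ℚ⟮θ⟯ ⊔ (CyclotomicZp.zpExtension 2).layer 1)) : ↥(ℚ⟮θ⟯ ⊔ (CyclotomicZp.zpExtension 2).layer 1)) = (-2 : ℝ) + (-4 : ℝ) * Real.sqrt 2 + ((-1 : ℝ) / 2) * x₁ + ((3 : ℝ) / 2) * (Real.sqrt 2 * x₁) + ((1 : ℝ) / 2) * (x₁ * x₁) := by
      rw [heVdef, Units.val_mkOfMulEqOne, NumberField.RingOfIntegers.coe_eq_algebraMap]
      simp only [map_add, map_sub, map_mul, map_pow, map_zero, map_neg, map_one, map_ofNat, hσ₃b, hσ₃x]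
      linear_combination (((19 : ℝ) / 2) + ((7 : ℝ) / 4) * (Real.sqrt 2) + (6 : ℝ) * x₁ + (3 : ℝ) * x₁ * (Real.sqrt 2)) * hσ₃r
    rw [hv]; linarith [hXXl₁, hXXu₁, hYXl₁, hYXu₁, hYXXl₁, hYXXu₁, hs2l, hs2u, hl₁, hu₁]
  have svσ₄ : 0 < σ₄ ((eV : 𝓞 ↥(ℚ⟮θ⟯ ⊔ (CyclotomicZp.zpExtension 2).layer 1)) : ↥(ℚ⟮θ⟯ ⊔ (CyclotomicZp.zpExtension 2).layer 1)) := by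
    have hv : σ₄ ((eV : 𝓞 ↥(ℚ⟮θ⟯ ⊔ (CyclotomicZp.zpExtension 2).layer 1)) : ↥(ℚ⟮θ⟯ ⊔ (CyclotomicZp.zpExtension 2).layer 1)) = (-2 : ℝ) + (4 : ℝ) * Real.sqrt 2 + ((-1 : ℝ) / 2) * x₁ + ((-3 : ℝ) / 2) * (Real.sqrt 2 * x₁) + ((1 : ℝ) / 2) * (x₁ * x₁) := by
      rw [heVdef, Units.val_mkOfMulEqOne, NumberField.RingOfIntegers.coe_eq_algebraMap]
      simp only [map_add, map_sub, map_mul, map_pow, map_zero, map_neg, map_one, map_ofNat, hσ₄b, hσ₄x]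
      linear_combination (((19 : ℝ) / 2) + ((-7 : ℝ) / 4) * (Real.sqrt 2) + (6 : ℝ) * x₁ + (-3 : ℝ) * x₁ * (Real.sqrt 2)) * hσ₄r
    rw [hv]; linarith [hXXl₁, hXXu₁, hYXl₁, hYXu₁, hYXXl₁, hYXXu₁, hs2l, hs2u, hl₁, hu₁]
  have svσ₅ : 0 < σ₅ ((eV : 𝓞 ↥(ℚ⟮θ⟯ ⊔ (CyclotomicZp.zpExtension 2).layer 1)) : ↥(ℚ⟮θ⟯ ⊔ (CyclotomicZp.zpExtension 2).layer 1)) := by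
    have hv : σ₅ ((eV : 𝓞 ↥(ℚ⟮θ⟯ ⊔ (CyclotomicZp.zpExtension 2).layer 1)) : ↥(ℚ⟮θ⟯ ⊔ (CyclotomicZp.zpExtension 2).layer 1)) = (-2 : ℝ) + (-4 : ℝ) * Real.sqrt 2 + ((-1 : ℝ) / 2) * x₂ + ((3 : ℝ) / 2) * (Real.sqrt 2 * x₂) + ((1 : ℝ) / 2) * (x₂ * x₂) := by
      rw [heVdef, Units.val_mkOfMulEqOne, NumberField.RingOfIntegers.coe_eq_algebraMap]
      simp only [map_add, map_sub, map_mul, map_pow, map_zero, map_neg, map_one, map_ofNat, hσ₅b, hσ₅x]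
      linear_combination (((19 : ℝ) / 2) + ((7 : ℝ) / 4) * (Real.sqrt 2) + (6 : ℝ) * x₂ + (3 : ℝ) * x₂ * (Real.sqrt 2)) * hσ₅r
    rw [hv]; linarith [hXXl₂, hXXu₂, hYXl₂, hYXu₂, hYXXl₂, hYXXu₂, hs2l, hs2u, hl₂, hu₂]
  have svσ₆ : 0 < σ₆ ((eV : 𝓞 ↥(ℚ⟮θ⟯ ⊔ (CyclotomicZp.zpExtension 2).layer 1)) : ↥(ℚ⟮θ⟯ ⊔ (CyclotomicZp.zpExtension 2).layer 1)) := by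
    have hv : σ₆ ((eV : 𝓞 ↥(ℚ⟮θ⟯ ⊔ (CyclotomicZp.zpExtension 2).layer 1)) : ↥(ℚ⟮θ⟯ ⊔ (CyclotomicZp.zpExtension 2).layer 1)) = (-2 : ℝ) + (4 : ℝ) * Real.sqrt 2 + ((-1 : ℝ) / 2) * x₂ + ((-3 : ℝ) / 2) * (Real.sqrt 2 * x₂) + ((1 : ℝ) / 2) * (x₂ * x₂) := by
      rw [heVdef, Units.val_mkOfMulEqOne, NumberField.RingOfIntegers.coe_eq_algebraMap]
      simp only [map_add, map_sub, map_mul, map_pow, map_zero, map_neg, map_one, map_ofNat, hσ₆b, hσ₆x]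
      linear_combination (((19 : ℝ) / 2) + ((-7 : ℝ) / 4) * (Real.sqrt 2) + (6 : ℝ) * x₂ + (-3 : ℝ) * x₂ * (Real.sqrt 2)) * hσ₆r
    rw [hv]; linarith [hXXl₂, hXXu₂, hYXl₂, hYXu₂, hYXXl₂, hYXXu₂, hs2l, hs2u, hl₂, hu₂]
  have hcardA : Fintype.card (↥(ℚ⟮θ⟯ ⊔ (CyclotomicZp.zpExtension 2).layer 1) →+* ℝ) = 6 := by rw [card_realEmbeddings, hfinA]
  have hneθ : ∀ {φ ψ : ↥(ℚ⟮θ⟯ ⊔ (CyclotomicZp.zpExtension 2).layer 1) →+* ℝ}, φ θ' ≠ ψ θ' → φ ≠ ψ := by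
    intro φ ψ h hφψ; exact h (by rw [hφψ])
  have hnet : ∀ {φ ψ : ↥(ℚ⟮θ⟯ ⊔ (CyclotomicZp.zpExtension 2).layer 1) →+* ℝ}, φ t' ≠ ψ t' → φ ≠ ψ := by
    intro φ ψ h hφψ; exact h (by rw [hφψ])
  have hss : Real.sqrt 2 ≠ -Real.sqrt 2 := by intro h; linarith [hs2l]
  have huniv : (Finset.univ : Finset (↥(ℚ⟮θ⟯ ⊔ (CyclotomicZp.zpExtension 2).layer 1) →+* ℝ)) = {σ₁, σ₂, σ₃, σ₄, σ₅, σ₆} := by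
    symm
    apply Finset.eq_of_subset_of_card_le (Finset.subset_univ _)
    rw [Finset.card_univ, hcardA]
    have h12 : σ₁ ≠ σ₂ := hnet (by rw [hσ₁t, hσ₂t]; exact hss)
    have h13 : σ₁ ≠ σ₃ := hneθ (by rw [hσ₁θ, hσ₃θ]; intro h; linarith)
    have h14 : σ₁ ≠ σ₄ := hneθ (by rw [hσ₁θ, hσ₄θ]; intro h; linarith)
    have h15 : σ₁ ≠ σ₅ := hneθ (by rw [hσ₁θ, hσ₅θ]; intro h; linarith)
    have h16 : σ₁ ≠ σ₆ := hneθ (by rw [hσ₁θ, hσ₆θ]; intro h; linarith)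
    have h23 : σ₂ ≠ σ₃ := hneθ (by rw [hσ₂θ, hσ₃θ]; intro h; linarith)
    have h24 : σ₂ ≠ σ₄ := hneθ (by rw [hσ₂θ, hσ₄θ]; intro h; linarith)
    have h25 : σ₂ ≠ σ₅ := hneθ (by rw [hσ₂θ, hσ₅θ]; intro h; linarith)
    have h26 : σ₂ ≠ σ₆ := hneθ (by rw [hσ₂θ, hσ₆θ]; intro h; linarith)
    have h35 : σ₃ ≠ σ₅ := hneθ (by rw [hσ₃θ, hσ₅θ]; intro h; linarith)
    have h36 : σ₃ ≠ σ₆ := hneθ (by rw [hσ₃θ, hσ₆θ]; intro h; linarith)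
    have h45 : σ₄ ≠ σ₅ := hneθ (by rw [hσ₄θ, hσ₅θ]; intro h; linarith)
    have h46 : σ₄ ≠ σ₆ := hneθ (by rw [hσ₄θ, hσ₆θ]; intro h; linarith)
    have h34 : σ₃ ≠ σ₄ := hnet (by rw [hσ₃t, hσ₄t]; exact hss)
    have h56 : σ₅ ≠ σ₆ := hnet (by rw [hσ₅t, hσ₆t]; exact hss)
    rw [Finset.card_insert_of_notMem (by simp [h12, h13, h14, h15, h16]), Finset.card_insert_of_notMem (by simp [h23, h24, h25, h26]),
      Finset.card_insert_of_notMem (by simp [h34, h35, h36]), Finset.card_insert_of_notMem (by simp [h45, h46]),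
      Finset.card_pair h56]
  have hposU : ∀ σ : ↥(ℚ⟮θ⟯ ⊔ (CyclotomicZp.zpExtension 2).layer 1) →+* ℝ,
      0 < σ ((eU : 𝓞 ↥(ℚ⟮θ⟯ ⊔ (CyclotomicZp.zpExtension 2).layer 1)) : ↥(ℚ⟮θ⟯ ⊔ (CyclotomicZp.zpExtension 2).layer 1)) := by
    intro σ
    have hσ : σ ∈ ({σ₁, σ₂, σ₃, σ₄, σ₅, σ₆} : Finset (↥(ℚ⟮θ⟯ ⊔ (CyclotomicZp.zpExtension 2).layer 1) →+* ℝ)) := huniv ▸ Finset.mem_univ σ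
    simp only [Finset.mem_insert, Finset.mem_singleton] at hσ
    rcases hσ with rfl | rfl | rfl | rfl | rfl | rfl
    · exact suσ₁
    · exact suσ₂
    · exact suσ₃
    · exact suσ₄
    · exact suσ₅
    · exact suσ₆
  have hposV : ∀ σ : ↥(ℚ⟮θ⟯ ⊔ (CyclotomicZp.zpExtension 2).layer 1) →+* ℝ,
      0 < σ ((eV : 𝓞 ↥(ℚ⟮θ⟯ ⊔ (CyclotomicZp.zpExtension 2).layer 1)) : ↥(ℚ⟮θ⟯ ⊔ (CyclotomicZp.zpExtension 2).layer 1)) := by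
    intro σ
    have hσ : σ ∈ ({σ₁, σ₂, σ₃, σ₄, σ₅, σ₆} : Finset (↥(ℚ⟮θ⟯ ⊔ (CyclotomicZp.zpExtension 2).layer 1) →+* ℝ)) := huniv ▸ Finset.mem_univ σ
    simp only [Finset.mem_insert, Finset.mem_singleton] at hσ
    rcases hσ with rfl | rfl | rfl | rfl | rfl | rfl
    · exact svσ₁
    · exact svσ₂
    · exact svσ₃
    · exact svσ₄
    · exact svσ₅
    · exact svσ₆
  -- residue witnesses: `u`, `v`, `uv` are not unit squares (ring maps `𝓞 A₁ → 𝓞 A₂ → 𝔽_ℓ`)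
  letI : Algebra ↥(ℚ⟮θ⟯ ⊔ (CyclotomicZp.zpExtension 2).layer 1) ↥(ℚ⟮θ⟯ ⊔ (CyclotomicZp.zpExtension 2).layer 2) := (inclusion h12).toRingHom.toAlgebra
  have halg12 : ∀ c, algebraMap ↥(ℚ⟮θ⟯ ⊔ (CyclotomicZp.zpExtension 2).layer 1) ↥(ℚ⟮θ⟯ ⊔ (CyclotomicZp.zpExtension 2).layer 2) c = inclusion h12 c := fun _ => rfl
  haveI : IsScalarTower ℚ ↥(ℚ⟮θ⟯ ⊔ (CyclotomicZp.zpExtension 2).layer 1) ↥(ℚ⟮θ⟯ ⊔ (CyclotomicZp.zpExtension 2).layer 2) := IsScalarTower.of_algebraMap_eq fun q => ((inclusion h12).commutes q).symm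
  set ι := (algebraMap (𝓞 ↥(ℚ⟮θ⟯ ⊔ (CyclotomicZp.zpExtension 2).layer 1)) (𝓞 ↥(ℚ⟮θ⟯ ⊔ (CyclotomicZp.zpExtension 2).layer 2)) : 𝓞 ↥(ℚ⟮θ⟯ ⊔ (CyclotomicZp.zpExtension 2).layer 1) →+* 𝓞 ↥(ℚ⟮θ⟯ ⊔ (CyclotomicZp.zpExtension 2).layer 2)) with hιdef
  have hιb : ((ι bA : 𝓞 ↥(ℚ⟮θ⟯ ⊔ (CyclotomicZp.zpExtension 2).layer 2)) : ↥(ℚ⟮θ⟯ ⊔ (CyclotomicZp.zpExtension 2).layer 2)) = inclusion (le_sup_left : ℚ⟮θ⟯ ≤ ℚ⟮θ⟯ ⊔ (CyclotomicZp.zpExtension 2).layer 2) (AdjoinSimple.gen ℚ θ) := by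
    rw [hιdef, NumberField.RingOfIntegers.coe_eq_algebraMap, ← IsScalarTower.algebraMap_apply (𝓞 ↥(ℚ⟮θ⟯ ⊔ (CyclotomicZp.zpExtension 2).layer 1)) (𝓞 ↥(ℚ⟮θ⟯ ⊔ (CyclotomicZp.zpExtension 2).layer 2)) ↥(ℚ⟮θ⟯ ⊔ (CyclotomicZp.zpExtension 2).layer 2),
      IsScalarTower.algebraMap_apply (𝓞 ↥(ℚ⟮θ⟯ ⊔ (CyclotomicZp.zpExtension 2).layer 1)) ↥(ℚ⟮θ⟯ ⊔ (CyclotomicZp.zpExtension 2).layer 1) ↥(ℚ⟮θ⟯ ⊔ (CyclotomicZp.zpExtension 2).layer 2), ← NumberField.RingOfIntegers.coe_eq_algebraMap, hbAval, halg12]; rfl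
  have he''0 : (fun x : ↥(ℚ⟮θ⟯ ⊔ (CyclotomicZp.zpExtension 2).layer 2) => x ^ 2 - 2)^[2] e'' = 0 := by
    apply (algebraMap ↥(ℚ⟮θ⟯ ⊔ (CyclotomicZp.zpExtension 2).layer 2) (AlgebraicClosure ℚ)).injective
    rw [NestedSqrtTwo.map_iterate, map_zero]; exact he0
  set sB : 𝓞 ↥(ℚ⟮θ⟯ ⊔ (CyclotomicZp.zpExtension 2).layer 2) := ⟨e'', NestedSqrtTwo.isIntegral he''0⟩ with hsBdef
  have hsBval : (sB : ↥(ℚ⟮θ⟯ ⊔ (CyclotomicZp.zpExtension 2).layer 2)) = e'' := rfl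
  have hιs : ι sA = sB ^ 2 - 2 := by
    apply NumberField.RingOfIntegers.coe_injective
    rw [hιdef, ← IsScalarTower.algebraMap_apply (𝓞 ↥(ℚ⟮θ⟯ ⊔ (CyclotomicZp.zpExtension 2).layer 1)) (𝓞 ↥(ℚ⟮θ⟯ ⊔ (CyclotomicZp.zpExtension 2).layer 2)) ↥(ℚ⟮θ⟯ ⊔ (CyclotomicZp.zpExtension 2).layer 2), IsScalarTower.algebraMap_apply (𝓞 ↥(ℚ⟮θ⟯ ⊔ (CyclotomicZp.zpExtension 2).layer 1)) ↥(ℚ⟮θ⟯ ⊔ (CyclotomicZp.zpExtension 2).layer 1) ↥(ℚ⟮θ⟯ ⊔ (CyclotomicZp.zpExtension 2).layer 2),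
      ← NumberField.RingOfIntegers.coe_eq_algebraMap, hsAval, halg12, map_sub, map_pow, map_ofNat, ← NumberField.RingOfIntegers.coe_eq_algebraMap, hsBval]
    apply Subtype.ext; rfl
  obtain ⟨homlin, -, -, -, -, -, -, -, -, -, -, -, -, -, -, -, -, -, -, -, -⟩ := layer_one_ids_d6728 bA xA RbA RxA
  have h₁ : ∀ w : (𝓞 ↥(ℚ⟮θ⟯ ⊔ (CyclotomicZp.zpExtension 2).layer 1))ˣ, eU ≠ w ^ 2 := by
    have hdisc : ((16 * Cubic.discr ⟨1, (0 : ℤ), (-29 : ℤ), (58 : ℤ)⟩ : ℤ) : ZMod 193) ≠ 0 := by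
      simp only [Cubic.discr]; decide
    obtain ⟨φ, hφb, hφe⟩ := exists_ringHom_ringOfIntegers_sup_layer_two_zmod' irreducible_cubic_d6728p hθ (isTotallyReal_adjoin_d6728p hθ) he he0
      (by norm_num : Nat.Prime 193) hdisc (x := (66 : ZMod 193)) (y := (23 : ZMod 193)) (by decide) (by decide)
    set ψ : 𝓞 ↥(ℚ⟮θ⟯ ⊔ (CyclotomicZp.zpExtension 2).layer 1) →+* ZMod 193 := φ.comp ι with hψdef
    have hψb : ψ bA = 66 := by rw [hψdef, RingHom.comp_apply]; exact hφb _ hιb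
    have hψs : ψ sA = 23 ^ 2 - 2 := by
      rw [hψdef, RingHom.comp_apply, hιs, map_sub, map_pow, hφe sB hsBval, map_ofNat]
    have hψx' : (4 : ZMod 193) * ψ xA = (-12 - 4 * 66 + 2 * 66 ^ 2) + (23 ^ 2 - 2) * (-2 - 3 * 66 + 66 ^ 2) := by
      have h0 := homlin
      rw [hs] at h0
      have h := congrArg ψ h0
      simp only [map_add, map_sub, map_mul, map_pow, map_ofNat, map_neg, map_one, hψb, hψs] at h
      linear_combination h
    have hψx : ψ xA = 191 := by
      have hinv : ((145 : ZMod 193) * 4) = 1 := by decide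
      calc ψ xA = ((145 : ZMod 193) * 4) * ψ xA := by rw [hinv, one_mul]
        _ = (145 : ZMod 193) * ((4 : ZMod 193) * ψ xA) := by ring
        _ = 191 := by rw [hψx']; decide
    have hv : ψ (((eU : (𝓞 ↥(ℚ⟮θ⟯ ⊔ (CyclotomicZp.zpExtension 2).layer 1))ˣ)) : 𝓞 ↥(ℚ⟮θ⟯ ⊔ (CyclotomicZp.zpExtension 2).layer 1)) = (106 : ZMod 193) := by
      simp only [Units.val_mul, heUdef, heVdef, Units.val_mkOfMulEqOne, map_mul, map_add, map_sub, map_pow, map_neg, map_one,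
        map_ofNat, hψb, hψx]
      decide
    intro w hw
    exact not_exists_eq_sq_of_map_not_isSquare ψ (eU) (by rw [hv]; decide) ⟨w, hw⟩
  have h₂ : ∀ w : (𝓞 ↥(ℚ⟮θ⟯ ⊔ (CyclotomicZp.zpExtension 2).layer 1))ˣ, eV ≠ w ^ 2 := by
    have hdisc : ((16 * Cubic.discr ⟨1, (0 : ℤ), (-29 : ℤ), (58 : ℤ)⟩ : ℤ) : ZMod 193) ≠ 0 := by
      simp only [Cubic.discr]; decide
    obtain ⟨φ, hφb, hφe⟩ := exists_ringHom_ringOfIntegers_sup_layer_two_zmod' irreducible_cubic_d6728p hθ (isTotallyReal_adjoin_d6728p hθ) he he0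
      (by norm_num : Nat.Prime 193) hdisc (x := (31 : ZMod 193)) (y := (23 : ZMod 193)) (by decide) (by decide)
    set ψ : 𝓞 ↥(ℚ⟮θ⟯ ⊔ (CyclotomicZp.zpExtension 2).layer 1) →+* ZMod 193 := φ.comp ι with hψdef
    have hψb : ψ bA = 31 := by rw [hψdef, RingHom.comp_apply]; exact hφb _ hιb
    have hψs : ψ sA = 23 ^ 2 - 2 := by
      rw [hψdef, RingHom.comp_apply, hιs, map_sub, map_pow, hφe sB hsBval, map_ofNat]
    have hψx' : (4 : ZMod 193) * ψ xA = (-12 - 4 * 31 + 2 * 31 ^ 2) + (23 ^ 2 - 2) * (-2 - 3 * 31 + 31 ^ 2) := by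
      have h0 := homlin
      rw [hs] at h0
      have h := congrArg ψ h0
      simp only [map_add, map_sub, map_mul, map_pow, map_ofNat, map_neg, map_one, hψb, hψs] at h
      linear_combination h
    have hψx : ψ xA = 93 := by
      have hinv : ((145 : ZMod 193) * 4) = 1 := by decide
      calc ψ xA = ((145 : ZMod 193) * 4) * ψ xA := by rw [hinv, one_mul]
        _ = (145 : ZMod 193) * ((4 : ZMod 193) * ψ xA) := by ring
        _ = 93 := by rw [hψx']; decide
    have hv : ψ (((eV : (𝓞 ↥(ℚ⟮θ⟯ ⊔ (CyclotomicZp.zpExtension 2).layer 1))ˣ)) : 𝓞 ↥(ℚ⟮θ⟯ ⊔ (CyclotomicZp.zpExtension 2).layer 1)) = (183 : ZMod 193) := by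
      simp only [Units.val_mul, heUdef, heVdef, Units.val_mkOfMulEqOne, map_mul, map_add, map_sub, map_pow, map_neg, map_one,
        map_ofNat, hψb, hψx]
      decide
    intro w hw
    exact not_exists_eq_sq_of_map_not_isSquare ψ (eV) (by rw [hv]; decide) ⟨w, hw⟩
  have h₁₂ : ∀ w : (𝓞 ↥(ℚ⟮θ⟯ ⊔ (CyclotomicZp.zpExtension 2).layer 1))ˣ, eU * eV ≠ w ^ 2 := by
    have hdisc : ((16 * Cubic.discr ⟨1, (0 : ℤ), (-29 : ℤ), (58 : ℤ)⟩ : ℤ) : ZMod 193) ≠ 0 := by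
      simp only [Cubic.discr]; decide
    obtain ⟨φ, hφb, hφe⟩ := exists_ringHom_ringOfIntegers_sup_layer_two_zmod' irreducible_cubic_d6728p hθ (isTotallyReal_adjoin_d6728p hθ) he he0
      (by norm_num : Nat.Prime 193) hdisc (x := (31 : ZMod 193)) (y := (23 : ZMod 193)) (by decide) (by decide)
    set ψ : 𝓞 ↥(ℚ⟮θ⟯ ⊔ (CyclotomicZp.zpExtension 2).layer 1) →+* ZMod 193 := φ.comp ι with hψdef
    have hψb : ψ bA = 31 := by rw [hψdef, RingHom.comp_apply]; exact hφb _ hιb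
    have hψs : ψ sA = 23 ^ 2 - 2 := by
      rw [hψdef, RingHom.comp_apply, hιs, map_sub, map_pow, hφe sB hsBval, map_ofNat]
    have hψx' : (4 : ZMod 193) * ψ xA = (-12 - 4 * 31 + 2 * 31 ^ 2) + (23 ^ 2 - 2) * (-2 - 3 * 31 + 31 ^ 2) := by
      have h0 := homlin
      rw [hs] at h0
      have h := congrArg ψ h0
      simp only [map_add, map_sub, map_mul, map_pow, map_ofNat, map_neg, map_one, hψb, hψs] at h
      linear_combination h
    have hψx : ψ xA = 93 := by
      have hinv : ((145 : ZMod 193) * 4) = 1 := by decide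
      calc ψ xA = ((145 : ZMod 193) * 4) * ψ xA := by rw [hinv, one_mul]
        _ = (145 : ZMod 193) * ((4 : ZMod 193) * ψ xA) := by ring
        _ = 93 := by rw [hψx']; decide
    have hv : ψ (((eU * eV : (𝓞 ↥(ℚ⟮θ⟯ ⊔ (CyclotomicZp.zpExtension 2).layer 1))ˣ)) : 𝓞 ↥(ℚ⟮θ⟯ ⊔ (CyclotomicZp.zpExtension 2).layer 1)) = (188 : ZMod 193) := by
      simp only [Units.val_mul, heUdef, heVdef, Units.val_mkOfMulEqOne, map_mul, map_add, map_sub, map_pow, map_neg, map_one,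
        map_ofNat, hψb, hψx]
      decide
    intro w hw
    exact not_exists_eq_sq_of_map_not_isSquare ψ (eU * eV) (by rw [hv]; decide) ⟨w, hw⟩
  exact four_le_card_totPosUnitsModSq_of_ne_sq eU eV hposU hposV h₁ h₂ h₁₂

end Summit.BirchSwinnertonDyer.BirchSwinnertonDyer.Theorems.AddKatoTwo

end
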